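import Summits.CriticalPhenomena.PercolationContinuityZ3.Theorems.PercNearOneGluingNoHeavyQuantMeanLightSiblings
import HarnessLib

/-!
# QUANT lane R8, T-DEC: EVERY SIBLING IS HULL-REDUCIBLE AT LOW FLOORS — a law on `{0..M}` with mean `m ∈ (i, i+1]` lies in the blob hull at every
# floor `x ≤ (m − i)/(M − i)` (Lemma P read as a blob-hull certificate); so the sibling step owes only forests of HIGH-FLOOR mean-heavy siblings
# (census-1 gen 28)

builds on p205010 (kernel theorem, internal audit signed; external expert review pending)

Support file (`--supports stmt-CriticalPhenomena-4575`), QUANT lane seat prim-quant-census-1 (gen 28); memo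
`run/shared/lean/prim/quant/prim-quant-census-1/g28/FAN-G28.md` §9.  Theorems only, standard axioms, no sorries.  Over census-2's LEMMA P
(`exists_twoPoint_decomposition`, `…QuantLawTwoPointDecomposition`: every law is a mixture of mean-`m` two-point laws `{lo, hi; g}` on its own atoms,
`lo < m < hi` or `lo = hi`), typer g40's blob hull (`InBlobHull`, `sdec_of_inBlobHull`, `inBlobHull_flaw_of_forall`, `sdec_siblings_of_reducible`) and
this seat's `…QuantMeanLightSiblings` (the case `i = 0`).

THE OBSERVATION.  A two-point law `{lo, hi; g}` with mean `m` IS a blob law: `lo` sure relays and one blob of size `hi − lo` at gate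
`g = (m − lo)/(hi − lo)` (`blobLaw [(hi − lo, g), (lo, 1)]`, `blobLaw_pair_apply`).  With `i` the integer below the mean (`i < m ≤ i + 1`) every
straddling component has `lo ≤ i`, `hi ≤ M`, hence `g ≥ (m − lo)/(M − lo) ≥ (m − i)/(M − i)`.  Therefore:
* **`inBlobHull_of_floor_le`**: a probability law on `{0..M}` with mean `m ∈ (i, i+1]` lies in `InBlobHull x m M` for every floor `x ≤ 1` with
  **`x·(M − i) ≤ m − i`** — for `i = 0` this is `x·M ≤ m` (`inBlobHull_of_mean_le_one`), for a mean-heavy law it is a LOW-FLOOR condition.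
* **`inBlobHull_gate_of_floor_le`**: the same for a gated sibling `gate s.ρ s.q` (mean `s.q·s.mean`).
* **`sdec_flaw_of_floor_le`**: a law-OK sibling forest in which EVERY member satisfies the floor condition (with its own `iₛ`) is `SDEC x (ftop L) (flaw L)`
  — any width, no oracle; **`sdec_siblings_of_floor_le`** (LIST BINDER): ONE such member + the oracle below `fgates L` ⟹ SDEC.
CONSEQUENCE FOR THE NODE.  `SiblingStep` ⟺ `GateStepN` owes only forests in which EVERY sibling is mean-heavy (`mₛ = qₛ·E[countₛ] > 1`) AND sits at a
HIGH floor, `x > (mₛ − iₛ)/(Mₛ − iₛ)` (`iₛ = ⌈mₛ⌉ − 1`) — e.g. a 2-chain `R[q](R[p])` with `m = q(1+p) > 1` is owed only at floors `x > q(1+p) − 1` (lead g46's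
slack condition, recovered), a 3-chain with `m ∈ (1,2]` only at `x > (m−1)/2`.  This is the precise form of "the residue is the near-sure / high-floor
corner" seen in the censuses of memo §3–§5 (at the true floor `x ≈ least marginal`, `x > (m − i)/(M − i)` forces the sibling's mass to sit near its top).

* `blobLaw_pair_apply`, **`inBlobHull_of_floor_le`**, **`inBlobHull_gate_of_floor_le`**, **`sdec_flaw_of_floor_le`**, **`sdec_siblings_of_floor_le`**.

HONEST STATUS.  Structural reduction (k-free); it does not touch the owed high-floor forests; `SiblingStep` ⟺ `GateStepN`, `UPartStep`,
`LightResidDECOracle`, `FarTreeRow` OPEN; RATE class (log\*) / honest sentence of `run/shared/lean/prim/quant/README.md` unchanged.  [this work].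
Extreme points of laws with prescribed mean are two-point laws (classical moment geometry; Lemma P is census-2's kernel form); nothing here is cited as a
published result.  The gluing rows served [cite: KozmaNitzan2024, Conjecture 3 (p. 15)]; product measure [cite: Grimmett1999, §1.3 p. 10].
-/

noncomputable section

open scoped BigOperators

namespace Summit.CriticalPhenomena.PercolationContinuityZ3.Theorems
namespace Quant
namespace LawDec

open Finset

/-! ### A two-point law is a blob law -/

/-- `blobLaw [(b, g), (a, 1)] h = (1 − g)·[h = a] + g·[h = a + b]` — `a` sure relays and a blob of size `b` at gate `g`. [this work] -/
theorem blobLaw_pair_apply (a b : ℕ) (g : ℝ) (h : ℕ) :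
    blobLaw [(b, g), (a, 1)] h = (1 - g) * (if h = a then (1 : ℝ) else 0) + g * (if h = a + b then (1 : ℝ) else 0) := by
  have inner : ∀ k : ℕ, blobLaw [(a, 1)] k = if k = a then (1 : ℝ) else 0 := by
    intro k
    rw [blobLaw_single_apply]
    split_ifs <;> ring
  show slice (blobLaw [(a, 1)]) b g h = _
  simp only [slice, inner]
  by_cases hbh : b ≤ h
  · rw [if_pos hbh]
    by_cases hh : h = a + b
    · rw [if_pos (show h - b = a by omega), if_pos hh]
    · rw [if_neg (show ¬ h - b = a by omega), if_neg hh]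
  · rw [if_neg hbh, if_neg (show ¬ h = a + b by omega)]

/-! ### Lemma P as a blob-hull certificate -/

/-- **EVERY LAW IS A HULL MEMBER AT LOW FLOORS.**  A probability law `μ` on `{0..M}` with mean `m ≤ i + 1` (`i : ℕ`; the natural choice is
`i = ⌈m⌉ − 1`, but only `m ≤ i+1` is used) lies in `InBlobHull x m M` for every `x ≤ 1` with `x·(M − i) ≤ m − i`: each component `{lo, hi; g}` of Lemma P is the blob law `[(hi − lo, g), (lo, 1)]` with
gate `g = (m − lo)/(hi − lo) ≥ (m − i)/(M − i) ≥ x` (`lo ≤ i`, `hi ≤ M`). [this work] -/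
theorem inBlobHull_of_floor_le (x m : ℝ) (M i : ℕ) (μ : ℕ → ℝ) (hμ0 : ∀ h, 0 ≤ μ h) (hμM : ∀ h, M < h → μ h = 0)
    (hμ1 : ∑ h ∈ Finset.range (M + 1), μ h = 1) (hmean : ∑ h ∈ Finset.range (M + 1), (h : ℝ) * μ h = m)
    (hmi : m ≤ (i : ℝ) + 1) (hx1 : x ≤ 1) (hx : x * ((M : ℝ) - i) ≤ m - i) : InBlobHull x m M μ := by
  classical
  obtain ⟨lam, g, lo, hi, h0, h1, hg, hlohi, hhi, hμ, hgen⟩ := exists_twoPoint_decomposition M M le_rfl μ hμ0 hμM hμ1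
  rw [hmean] at hgen
  -- genuine components only
  let P : (Fin (M + 1) × Fin (M + 1)) → Prop := fun r => 0 < lam r
  -- the gate actually used (`1` for point masses)
  let g' : (Fin (M + 1) × Fin (M + 1)) → ℝ := fun r => if lo r < hi r then g r else 1
  have hTP : ∀ r h, 0 < lam r →
      blobLaw [(hi r - lo r, g' r), (lo r, 1)] h
        = g r * (if h = hi r then (1 : ℝ) else 0) + (1 - g r) * (if h = lo r then (1 : ℝ) else 0) := by
    intro r h hr
    rw [blobLaw_pair_apply, Nat.add_sub_cancel' (hlohi r)]
    by_cases hlt : lo r < hi r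
    · simp only [g', if_pos hlt]; ring
    · have heq : lo r = hi r := le_antisymm (hlohi r) (not_lt.1 hlt)
      simp only [g', if_neg hlt, heq]; ring
  -- gate lower bound for straddling components
  have hgate : ∀ r, 0 < lam r → lo r < hi r → x ≤ g r := by
    intro r hr hlt
    obtain ⟨_, _, hmeanr, hstr⟩ := hgen r hr
    obtain ⟨hlo, hhi'⟩ := hstr hlt
    have hloi : lo r ≤ i := by
      have : (lo r : ℝ) < (i : ℝ) + 1 := lt_of_lt_of_le hlo hmi
      exact_mod_cast (show lo r < i + 1 by exact_mod_cast this) |> Nat.lt_succ_iff.mp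
    have hhiM : (hi r : ℝ) ≤ M := by exact_mod_cast hhi r
    have hloi' : (lo r : ℝ) ≤ i := by exact_mod_cast hloi
    have hd : (0 : ℝ) < (hi r : ℝ) - lo r := by
      have : (lo r : ℝ) < hi r := by exact_mod_cast hlt
      linarith
    -- `(hi − lo)·g = m − lo ≥ x·(M − lo) ≥ x·(hi − lo)` when `0 ≤ x`; trivial when `x ≤ 0`
    rcases le_or_gt x 0 with hx0 | hx0
    · exact hx0.trans (hg r).1
    · have e : ((hi r : ℝ) - lo r) * g r = m - lo r := by linarith [hmeanr]
      have h2 : x * ((M : ℝ) - lo r) ≤ m - lo r := by nlinarith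
      have h3 : x * ((hi r : ℝ) - lo r) ≤ x * ((M : ℝ) - lo r) := mul_le_mul_of_nonneg_left (by linarith) hx0.le
      by_contra hlt'
      have : ((hi r : ℝ) - lo r) * g r < ((hi r : ℝ) - lo r) * x := mul_lt_mul_of_pos_left (not_le.1 hlt') hd
      nlinarith
  refine ⟨{r // P r}, inferInstance, fun r => lam r.1, fun r => [(hi r.1 - lo r.1, g' r.1), (lo r.1, 1)],
    fun r => h0 r.1, ?_, fun r p hp => ?_, fun r => ?_, fun r => ?_, fun h => ?_⟩
  · -- weights
    have e : ∑ r : {r // P r}, lam r.1 = ∑ r ∈ Finset.univ.filter P, lam r :=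
      (Finset.sum_subtype (Finset.univ.filter P) (fun r => by simp [P]) lam).symm
    rw [e, Finset.sum_filter]
    rw [← h1]
    refine Finset.sum_congr rfl fun r _ => ?_
    by_cases hr : P r
    · rw [if_pos hr]
    · rw [if_neg hr]; exact (le_antisymm (not_lt.1 hr) (h0 r)).symm ▸ rfl
  · -- gates
    simp only [List.mem_cons, List.not_mem_nil, or_false] at hp
    rcases hp with rfl | rfl
    · refine ⟨?_, ?_⟩
      · show x ≤ g' r.1
        by_cases hlt : lo r.1 < hi r.1
        · simp only [g', if_pos hlt]; exact hgate r.1 r.2 hlt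
        · simp only [g', if_neg hlt]; exact hx1
      · show g' r.1 ≤ 1
        by_cases hlt : lo r.1 < hi r.1
        · simp only [g', if_pos hlt]; exact (hg r.1).2
        · simp only [g', if_neg hlt]; exact le_rfl
    · exact ⟨hx1, le_rfl⟩
  · -- tops
    show blobTop [(hi r.1 - lo r.1, g' r.1), (lo r.1, 1)] ≤ M
    simp only [blobTop, zero_add]
    have := hhi r.1; have := hlohi r.1; omega
  · -- means
    show blobMean [(hi r.1 - lo r.1, g' r.1), (lo r.1, 1)] = m
    simp only [blobMean, zero_add, mul_one]
    obtain ⟨_, _, hmeanr, _⟩ := hgen r.1 r.2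
    rw [Nat.cast_sub (hlohi r.1)]
    by_cases hlt : lo r.1 < hi r.1
    · simp only [g', if_pos hlt]; linarith [hmeanr]
    · have heq : lo r.1 = hi r.1 := le_antisymm (hlohi r.1) (not_lt.1 hlt)
      simp only [g', if_neg hlt, heq, sub_self, zero_mul, add_zero]
      rw [heq, sub_self, zero_mul, add_zero] at hmeanr
      exact hmeanr
  · -- the law
    have e : ∑ r : {r // P r}, lam r.1 * blobLaw [(hi r.1 - lo r.1, g' r.1), (lo r.1, 1)] h
        = ∑ r ∈ Finset.univ.filter P, lam r * blobLaw [(hi r - lo r, g' r), (lo r, 1)] h :=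
      (Finset.sum_subtype (Finset.univ.filter P) (fun r => by simp [P])
        (fun r => lam r * blobLaw [(hi r - lo r, g' r), (lo r, 1)] h)).symm
    rw [e, Finset.sum_filter, hμ h]
    refine Finset.sum_congr rfl fun r _ => ?_
    by_cases hr : P r
    · rw [if_pos hr, hTP r h hr]
    · have hz : lam r = 0 := le_antisymm (not_lt.1 hr) (h0 r)
      rw [if_neg hr, hz, zero_mul]

/-! ### Siblings and forests -/

/-- **A GATED SIBLING IS A HULL MEMBER AT LOW FLOORS**: law-OK `s`, gated mean `m = s.q·s.mean ≤ i+1`, `x ≤ 1`, `x·(s.M − i) ≤ m − i`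
⟹ `InBlobHull x m s.M (gate s.ρ s.q)`. [this work] -/
theorem inBlobHull_gate_of_floor_le {x : ℝ} (s : Sib) (hs : s.LawOK) (i : ℕ)
    (hmi : s.q * s.mean ≤ (i : ℝ) + 1) (hx1 : x ≤ 1) (hx : x * ((s.M : ℝ) - i) ≤ s.q * s.mean - i) :
    InBlobHull x (s.q * s.mean) s.M (gate s.ρ s.q) := by
  obtain ⟨hq0, hq1, ρ0, ρM, ρ1⟩ := hs
  obtain ⟨g0, gM, g1⟩ := gate_laws s.M s.ρ s.q hq0.le hq1.le ρ0 ρM ρ1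
  have gmean : ∑ h ∈ Finset.range (s.M + 1), (h : ℝ) * gate s.ρ s.q h = s.q * s.mean := by
    rw [sum_mul_gate]; rfl
  exact inBlobHull_of_floor_le x (s.q * s.mean) s.M i (gate s.ρ s.q) g0 gM g1 gmean hmi hx1 hx

/-- **A FOREST OF LOW-FLOOR SIBLINGS IS SDEC — any width, no oracle**: law-OK siblings, `0 < x < 1`, and for every member an integer `i` with
`s.q·s.mean ≤ i + 1` and `x·(s.M − i) ≤ s.q·s.mean − i`. [this work] -/
theorem sdec_flaw_of_floor_le {x : ℝ} (hx0 : 0 < x) (hx1 : x < 1) (L : List Sib) (hL : ∀ s ∈ L, s.LawOK)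
    (hfl : ∀ s ∈ L, ∃ i : ℕ, s.q * s.mean ≤ (i : ℝ) + 1 ∧ x * ((s.M : ℝ) - i) ≤ s.q * s.mean - i) :
    SDEC x (ftop L) (flaw L) := by
  refine sdec_of_inBlobHull hx0 hx1 (inBlobHull_flaw_of_forall L fun s hs => ?_)
  obtain ⟨i, hmi, hx⟩ := hfl s hs
  exact inBlobHull_gate_of_floor_le s (hL s hs) i hmi hx1.le hx

/-- **ON THE NODE'S LIST BINDER, ONE LOW-FLOOR SIBLING FREES THE FOREST**: tree-OK list, the oracle below `fgates L`, and some member with an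
integer `i`, `s.q·s.mean ≤ i + 1`, such that `x·(s.M − i) ≤ s.q·s.mean − i` ⟹ `SDEC x (ftop L) (flaw L)`.  So the sibling step owes only forests
in which EVERY sibling has `x·(Mₛ − iₛ) > mₛ − iₛ` (mean-heavy and high-floor). [this work] -/
theorem sdec_siblings_of_floor_le {x : ℝ} (hx0 : 0 < x) (L : List Sib) (hL : ∀ s ∈ L, s.TreeOK x)
    (hO : ∀ (x' : ℝ) (n' M' : ℕ) (μ' : ℕ → ℝ), n' < fgates L → TreeBuiltN x' n' M' μ' → SDEC x' M' μ')
    (hex : ∃ s ∈ L, ∃ i : ℕ, s.q * s.mean ≤ (i : ℝ) + 1 ∧ x * ((s.M : ℝ) - i) ≤ s.q * s.mean - i) :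
    SDEC x (ftop L) (flaw L) := by
  obtain ⟨s, hs, i, hmi, hx⟩ := hex
  obtain ⟨_, hq1, hxq, hT, _⟩ := hL s hs
  obtain ⟨_, hx₁1, _, _, _, _⟩ := hT.lawFacts
  have hx1 : x ≤ 1 := by nlinarith
  exact sdec_siblings_of_reducible hx0 L hL hO ⟨s, hs, _, inBlobHull_gate_of_floor_le s (hL s hs).lawOK i hmi hx1 hx⟩

end LawDec
end Quant
end Summit.CriticalPhenomena.PercolationContinuityZ3.Theorems
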